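import Literature.Analysis.FluidPDE.FluidComputer.OneShot
import HarnessLib

/-!
# Fluid computer blueprint — the ARCHITECTURE layer: a shadowed finite-dimensional circuit design

HONEST FRAMING: low prior, high value-of-information experiment on Tao's machine paradigm; NOT a
claim that NS blows up. Nothing in this file constructs a design; every theorem is an implication
from a structure that, as far as anyone knows, is uninhabited for the true equations.

`PumpCascade.lean` / `RobustPumpCascade.lean` / `OneShot.lean` type Tao's machine programme
(J. Amer. Math. Soc. 29 (2016), §1.3) as one `PumpGadget` per generation: input / output classes
`In`, `Out ⊆ L²`, the context-free realisation axiom `fires`, self-replication `replicate`, noise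
tolerance `margin` in a stated norm, and — as a HYPOTHESIS of the downstream theorems — liveness
`Live` (every loaded state has a trajectory outliving the tick). The blueprint's calibrations showed
what those interfaces cannot see: `In` / `Out` are arbitrary sets, so the realisation axiom is ONE
opaque field carrying all the fluid mechanics, and a one-shot (doomed) class inhabits everything but
`Live`. The blueprint's `ASSEMBLY.md` (§2f.5, recommendation R2) asked for the layer BELOW the
gadget: a design from which `fires`, `replicate`, `margin` and `Live` are THEOREMS, each resting on
a separately named — and separately refutable — field. This file is that layer.

## The structure `ShadowedCircuit S O s`

A design over the spec sheet `S`, with a finite-dimensional OBSERVABLE space `O` (a pseudo-metric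
space: in a concrete design, the coefficients of `m` design modes at scale `λ_n`, in rescaled units)
and a junk-norm order `s`. Its fields, grouped as the blueprint's table groups them:

* READOUT (static design): `read n : L² → O` (generation-`n` readout, `Λ`-Lipschitz from `L²` in
  units of `√E_n`, `read_lip`), `recon n : O → L²` (the clean design state with a given readout,
  `read_recon`), `junk n : L² → ℝ≥0∞` (size of the non-design part at generation `n`, `1`-Lipschitz
  in the scale-adapted norm `X^s_{λ_n}`, `junk_perturb`; zero on design states, `junk_recon`).
* REGIONS and THRESHOLDS (static design): `Ain ⊇ ball(Acore, δ)` (`core_thick`), `Aout ⊆ O`; junk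
  thresholds `0 ≤ jcore < jin` (loaded), `jrun` (running).
* STATICS (von Neumann's part — self-reproduction of the DESIGN, checkable by finite-dimensional
  computation for a concrete self-similar design): `handoff` — a state read in `Aout` at generation
  `n` with running junk is read in `Acore` at generation `n+1` with core junk (the output region of
  one generation IS the loaded core of the next, junk included: erasure of the spent generation is
  part of the claim); `floor_cert` — loaded states carry high-frequency energy `≥ E_n` at `|ξ| ≥ λ_n`.
* CIRCUIT (finite-dimensional dynamics `Φ` on `O`, in rescaled time; certifiable by validated ODE
  numerics for a concrete design): `dat` — from every point of `Ain` the circuit reaches, within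
  rescaled time `τc`, a point whose closed `δsh`-ball lies in `Aout` (a delayed abrupt transition
  with margin `δsh`).
* CLOCK: `unit n` — physical time per unit rescaled time at generation `n`, `unit n * τc ≤ T_n`.
* DYNAMICS (idea-bound — ALL the infinite-dimensional fluid mechanics, now split in two named
  pieces, each quantified over every `H¹⁰_df`-mild Navier–Stokes trajectory from every datum,
  UNGUARDED up to the trajectory's own lifespan): `shadow` — while alive and for rescaled time
  `≤ τc` after being loaded at generation `n`, the readout stays `δsh`-close to the circuit orbit
  of the initial readout; `leak` — meanwhile the generation-`n` junk stays below the running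
  threshold.
* SEED: a divergence-free Schwartz datum read in `Acore` at generation `0` with core junk.

## What is DERIVED (soft, unconditional given the structure)

* `ShadowedCircuit.fires` — the realisation axiom of every generation's gadget
  (`dat` + `shadow` + `leak` + `handoff`);
* `ShadowedCircuit.Out_subset_In` — self-replication (`core_thick`, `jcore < jin`);
* `ShadowedCircuit.toPumpCascade` — hence a `PumpCascade S`, and everything downstream of it
  (finite lifespan `≤ T_*` for `α > 0`, `η > 1/4`; `X5a` given the mild facts);
* `ShadowedCircuit.toRobustPumpCascade` — noise tolerance in `X^s` with the EXPLICIT relative radius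
  `rho = min (δ/Λ) (jin - jcore) > 0` (`read_lip` + `junk_perturb`): stable clocked blow-up;
* `ShadowedCircuit.live` — LIVENESS, given the `H¹⁰` mild theory (`H10MildTheory`, proved on the
  summit side) and ONE static hypothesis `H10Control` (states shadowing the circuit tube with
  running junk have bounded `H¹⁰` norm, generation by generation — dischargeable for a concrete
  design when `s ≥ 10`): a loaded state all of whose trajectories died within the tick would have a
  maximal trajectory with unbounded `H¹⁰` norm (continuation criterion) that `shadow` + `leak` keep
  inside an `H¹⁰`-bounded set — contradiction. So the one-shot degeneracy of `OneShot.lean` is NOT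
  an inhabitant: `ShadowedCircuit.not_doomed_of_mem_In`;
* non-degeneracy: every input / output class contains the clean design states
  (`recon_mem_In`, `recon_mem_Out`, `In_nonempty`).

## Honest ceiling (calibration, informal — see the blueprint's `ASSEMBLY.md` §2g)

As an ABSTRACT type (arbitrary `O`, `read`, `junk`, `Φ`) the structure is still inhabitable from a
single LIVE clocked blow-up orbit that is uniformly `X^s`-stable over each tick (take `O = ℝ`
reading a phase observable, `Φ` the orbit's observable curve, `junk` the `X^s`-distance to the
orbit's generation-`n` segment): the architecture layer types "stably shadowed, live, clocked
self-similar blow-up", not "computation". Its teeth are in the CONCRETE reading — `O = ℝ^m` the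
coefficients of finitely many design modes, `recon` self-similar (`IsSelfSimilar`), `Φ` a Galerkin
truncation of the true Navier–Stokes nonlinearity at one scale — where `dat` is a finite-dimensional
certificate, `handoff` / `floor_cert` / `read_lip` / `junk_perturb` / `H10Control` are design-level
checks, and `shadow` / `leak` are the two measurable, idea-bound claims about the true flow near a
finite-dimensional circuit: exactly the "shadowing by an inviscid finite-dimensional gate design
with noise tolerance" that Tao (§1.3) names as the missing ingredient. Nothing here asserts they
hold. [cite: Tao2016AveragedNS, §1.3 pp. 10–11]
-/

noncomputable section

open MeasureTheory Set Filter Topology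
open scoped ENNReal NNReal SchwartzMap

namespace Literature.Analysis.FluidPDE.FluidComputer

open Literature.Analysis.FluidPDE.Tao2016
open Literature.Analysis.FunctionSpaces (eFourierSobolevNorm)

/-! ### §0. A live cascade has no doomed loaded state -/

/-- In a live pump cascade no loaded `H¹⁰_df` state of generation `n` is doomed within the tick
`T_n` (liveness gives a trajectory from it outliving `T_n`). [folklore] -/
theorem PumpCascade.Live.not_doomed {S : CascadeSpecs} {L : PumpCascade S} (hlive : L.Live) (n : ℕ)
    {v : L2C} (hv : v ∈ (L.G n).In) (h10 : MemH10df v) : ¬ Doomed (L.G n).T v := by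
  intro hd
  obtain ⟨S', hS', u, hu⟩ := hlive n v hv h10
  exact absurd (hd.lifespan_le h10 hu) (not_le.2 hS')

/-! ### §1. The architecture: a shadowed finite-dimensional circuit design -/

/-- **A shadowed circuit design** for Tao's machine over the spec sheet `S`, with finite-dimensional
observable space `O` and junk measured in the scale-adapted norm `X^s`. READOUT / REGIONS /
STATICS / CIRCUIT / CLOCK fields are design-level (checkable for a concrete finite-dimensional
self-similar design); the two DYNAMICS fields `shadow`, `leak` are idea-bound claims about every
`H¹⁰_df`-mild trajectory of the true Navier–Stokes equations (`ν = 1`, Euler form), unguarded up to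
lifespan; SEED is the ignition datum. From these, the gadget-level axioms `fires`, `replicate`,
`margin`, and (with `H10Control` and the mild theory) `Live` are theorems below. Nothing asserts
such a design exists. [cite: Tao2016AveragedNS, §1.3 pp. 10–11] -/
structure ShadowedCircuit (S : CascadeSpecs) (O : Type*) [PseudoMetricSpace O] (s : ℝ) where
  /-- READOUT: the generation-`n` observable of a state (rescaled units) -/
  read : ℕ → L2C → O
  /-- the clean design state of generation `n` with a given readout -/
  recon : ℕ → O → L2C
  /-- the size of the non-design ("junk") part of a state at generation `n` -/
  junk : ℕ → L2C → ℝ≥0∞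
  /-- Lipschitz modulus of the readouts -/
  Λ : ℝ
  Λ_pos : 0 < Λ
  /-- the readout of generation `n` is `Λ`-Lipschitz from `L²` measured in units of `√E_n` -/
  read_lip : ∀ (n : ℕ) (v w : L2C), dist (read n v) (read n w) * Real.sqrt (S.Emin n) ≤ Λ * ‖v - w‖
  /-- the junk functional of generation `n` is `1`-Lipschitz in `X^s` at scale `λ_n` -/
  junk_perturb : ∀ (n : ℕ) (v w : L2C), junk n w ≤ junk n v + scaledSobolevNorm s (S.lam n) (w - v)
  /-- design states read as designed -/
  read_recon : ∀ (n : ℕ) (p : O), read n (recon n p) = p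
  /-- design states carry no junk -/
  junk_recon : ∀ (n : ℕ) (p : O), junk n (recon n p) = 0
  /-- REGIONS: admissible input readouts -/
  Ain : Set O
  /-- loaded-core readouts (where a fresh generation starts) -/
  Acore : Set O
  /-- output readouts (where a generation hands off) -/
  Aout : Set O
  /-- thickness of the core inside the input region -/
  δ : ℝ
  δ_pos : 0 < δ
  core_thick : ∀ p ∈ Acore, Metric.ball p δ ⊆ Ain
  /-- junk thresholds (relative, in units of `√E_n`): core-loaded, loaded, running -/
  jcore : ℝ
  jin : ℝ
  jrun : ℝ
  jcore_nonneg : 0 ≤ jcore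
  jcore_lt : jcore < jin
  /-- STATICS (self-reproduction of the design, with erasure): read in `Aout` at generation `n`
  with running junk ⇒ read in `Acore` at generation `n+1` with core junk -/
  handoff : ∀ (n : ℕ) (v : L2C), read n v ∈ Aout →
    junk n v ≤ ENNReal.ofReal (jrun * Real.sqrt (S.Emin n)) →
      read (n + 1) v ∈ Acore ∧ junk (n + 1) v ≤ ENNReal.ofReal (jcore * Real.sqrt (S.Emin (n + 1)))
  /-- STATICS: loaded states of generation `n` carry energy `≥ E_n` at frequencies `|ξ| ≥ λ_n` -/
  floor_cert : ∀ (n : ℕ) (v : L2C), read n v ∈ Ain →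
    junk n v ≤ ENNReal.ofReal (jin * Real.sqrt (S.Emin n)) →
      ENNReal.ofReal (S.Emin n) ≤ highFreqEnergy (S.lam n) v
  /-- CIRCUIT: the finite-dimensional design dynamics on `O`, in rescaled time -/
  Φ : ℝ → O → O
  /-- rescaled cycle time -/
  τc : ℝ
  τc_nonneg : 0 ≤ τc
  /-- shadowing tolerance -/
  δsh : ℝ
  δsh_nonneg : 0 ≤ δsh
  /-- delayed abrupt transition with margin: from `Ain` the circuit reaches, within rescaled time
  `τc`, a point whose closed `δsh`-ball lies in `Aout` -/
  dat : ∀ p ∈ Ain, ∃ σ : ℝ, 0 ≤ σ ∧ σ ≤ τc ∧ Metric.closedBall (Φ σ p) δsh ⊆ Aout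
  /-- CLOCK: physical time per unit rescaled time at generation `n` -/
  unit : ℕ → ℝ
  unit_pos : ∀ n, 0 < unit n
  /-- one cycle fits in the spec's firing allowance -/
  clock : ∀ n, unit n * τc ≤ S.Tmax n
  /-- DYNAMICS (idea-bound): SHADOWING — every mild Navier–Stokes trajectory loaded at generation
  `n` at a time `t ≥ 0` has, while alive and for rescaled time `σ ≤ τc`, its readout within `δsh`
  of the circuit orbit of its readout at time `t` -/
  shadow : ∀ (n : ℕ) (a : L2C) (S' : ℝ) (u : ℝ → L2C), IsMildSolutionFor eulerForm a (Ico 0 S') u →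
    ∀ t : ℝ, 0 ≤ t → read n (u t) ∈ Ain → junk n (u t) ≤ ENNReal.ofReal (jin * Real.sqrt (S.Emin n)) →
      ∀ σ : ℝ, 0 ≤ σ → σ ≤ τc → t + unit n * σ < S' →
        dist (read n (u (t + unit n * σ))) (Φ σ (read n (u t))) ≤ δsh
  /-- DYNAMICS (idea-bound): LEAKAGE — meanwhile its generation-`n` junk stays below the running
  threshold -/
  leak : ∀ (n : ℕ) (a : L2C) (S' : ℝ) (u : ℝ → L2C), IsMildSolutionFor eulerForm a (Ico 0 S') u →
    ∀ t : ℝ, 0 ≤ t → read n (u t) ∈ Ain → junk n (u t) ≤ ENNReal.ofReal (jin * Real.sqrt (S.Emin n)) →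
      ∀ σ : ℝ, 0 ≤ σ → σ ≤ τc → t + unit n * σ < S' →
        junk n (u (t + unit n * σ)) ≤ ENNReal.ofReal (jrun * Real.sqrt (S.Emin n))
  /-- SEED: the ignition datum -/
  u₀ : 𝓢(EuclideanSpace ℝ (Fin 3), EuclideanSpace ℝ (Fin 3))
  divFree : VectorCalculus.IsDivFree ⇑u₀
  memH10df : MemH10df (schwartzL2 u₀)
  /-- it is read in the loaded core at generation `0` … -/
  seed_read : read 0 (schwartzL2 u₀) ∈ Acore
  /-- … with core junk -/
  seed_junk : junk 0 (schwartzL2 u₀) ≤ ENNReal.ofReal (jcore * Real.sqrt (S.Emin 0))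

namespace ShadowedCircuit

variable {S : CascadeSpecs} {O : Type*} [PseudoMetricSpace O] {s : ℝ} (A : ShadowedCircuit S O s)

/-! ### §2. The input and output classes DEFINED by the design -/

/-- The generation-`n` **input class** of the design: read in `Ain` at generation `n`, junk below
the loaded threshold `jin √E_n`. [cite: Tao2016AveragedNS, §1.3 pp. 10–11] -/
def In (n : ℕ) : Set L2C :=
  {v | A.read n v ∈ A.Ain ∧ A.junk n v ≤ ENNReal.ofReal (A.jin * Real.sqrt (S.Emin n))}

/-- The generation-`n` **output class** of the design: read in the loaded CORE at generation `n+1`,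
with core junk there (the output of a generation is typed by the NEXT generation's readout). [cite: Tao2016AveragedNS, §1.3 pp. 10–11] -/
def Out (n : ℕ) : Set L2C :=
  {v | A.read (n + 1) v ∈ A.Acore ∧
    A.junk (n + 1) v ≤ ENNReal.ofReal (A.jcore * Real.sqrt (S.Emin (n + 1)))}

/-- Membership in the input class, unfolded. [folklore] -/
theorem mem_In {n : ℕ} {v : L2C} :
    v ∈ A.In n ↔ A.read n v ∈ A.Ain ∧ A.junk n v ≤ ENNReal.ofReal (A.jin * Real.sqrt (S.Emin n)) :=
  Iff.rfl

/-- Membership in the output class, unfolded. [folklore] -/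
theorem mem_Out {n : ℕ} {v : L2C} :
    v ∈ A.Out n ↔ A.read (n + 1) v ∈ A.Acore ∧
      A.junk (n + 1) v ≤ ENNReal.ofReal (A.jcore * Real.sqrt (S.Emin (n + 1))) :=
  Iff.rfl

/-- The loaded core lies in the input region. [folklore] -/
theorem Acore_subset_Ain : A.Acore ⊆ A.Ain :=
  fun p hp => A.core_thick p hp (Metric.mem_ball_self A.δ_pos)

/-- Core junk is loaded junk: `jcore √E ≤ jin √E`. [folklore] -/
theorem ofReal_jcore_le (n : ℕ) :
    ENNReal.ofReal (A.jcore * Real.sqrt (S.Emin n)) ≤ ENNReal.ofReal (A.jin * Real.sqrt (S.Emin n)) :=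
  ENNReal.ofReal_le_ofReal (mul_le_mul_of_nonneg_right A.jcore_lt.le (Real.sqrt_nonneg _))

/-- A state read in the core at generation `n` with core junk is a generation-`n` input state. [folklore] -/
theorem mem_In_of_core {n : ℕ} {v : L2C} (hr : A.read n v ∈ A.Acore)
    (hj : A.junk n v ≤ ENNReal.ofReal (A.jcore * Real.sqrt (S.Emin n))) : v ∈ A.In n :=
  ⟨A.Acore_subset_Ain hr, hj.trans (A.ofReal_jcore_le n)⟩

/-- **SELF-REPLICATION is a theorem of the design**: `Out n ⊆ In (n+1)`. [cite: Tao2016AveragedNS, §1.3 pp. 10–11] -/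
theorem Out_subset_In (n : ℕ) : A.Out n ⊆ A.In (n + 1) :=
  fun _ hv => A.mem_In_of_core hv.1 hv.2

/-- The seed is a generation-`0` input state. [folklore] -/
theorem seed_mem_In : schwartzL2 A.u₀ ∈ A.In 0 :=
  A.mem_In_of_core A.seed_read A.seed_junk

/-- Non-degeneracy: the clean design state with an admissible readout is an input state. [folklore] -/
theorem recon_mem_In (n : ℕ) {p : O} (hp : p ∈ A.Ain) : A.recon n p ∈ A.In n := by
  refine ⟨?_, ?_⟩
  · rw [A.read_recon]; exact hp
  · rw [A.junk_recon]; exact zero_le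

/-- Non-degeneracy: the clean generation-`(n+1)` design state with a core readout is a
generation-`n` output state. [folklore] -/
theorem recon_mem_Out (n : ℕ) {p : O} (hp : p ∈ A.Acore) : A.recon (n + 1) p ∈ A.Out n := by
  refine ⟨?_, ?_⟩
  · rw [A.read_recon]; exact hp
  · rw [A.junk_recon]; exact zero_le

/-- Non-degeneracy: every input class and every output class is inhabited (the seed's core readout
reconstructed at that generation) — unlike the one-shot library of `OneShot.lean`. [folklore] -/
theorem In_nonempty (n : ℕ) : (A.In n).Nonempty :=
  ⟨A.recon n (A.read 0 (schwartzL2 A.u₀)), A.recon_mem_In n (A.Acore_subset_Ain A.seed_read)⟩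

/-- Every output class is inhabited. [folklore] -/
theorem Out_nonempty (n : ℕ) : (A.Out n).Nonempty :=
  ⟨A.recon (n + 1) (A.read 0 (schwartzL2 A.u₀)), A.recon_mem_Out n A.seed_read⟩

/-! ### §3. REALISATION is a theorem of the design -/

/-- One cycle of generation `n` fits inside the tick: `unit n * σ ≤ unit n * τc` for `σ ≤ τc`. [folklore] -/
theorem unit_mul_le {n : ℕ} {σ : ℝ} (hσ : σ ≤ A.τc) : A.unit n * σ ≤ A.unit n * A.τc :=
  mul_le_mul_of_nonneg_left hσ (A.unit_pos n).le

/-- **REALISATION (`PumpGadget.fires`) is a theorem of the design**: every mild Navier–Stokes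
trajectory loaded at generation `n` at time `t ≥ 0` and alive past `t + unit n · τc` passes through
the generation-`n` output class within that time — `dat` picks the circuit's transition time `σ`,
`shadow` puts the true readout in the `δsh`-ball around the circuit's, hence in `Aout`, `leak`
bounds the junk, and `handoff` reads the result as a loaded core of generation `n+1`. [cite: Tao2016AveragedNS, §1.3 pp. 10–11] -/
theorem fires (n : ℕ) (a : L2C) (S' : ℝ) (u : ℝ → L2C)
    (hu : IsMildSolutionFor eulerForm a (Ico 0 S') u) (t : ℝ) (ht : 0 ≤ t) (hin : u t ∈ A.In n)
    (hT : t + A.unit n * A.τc < S') :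
    ∃ r : ℝ, t ≤ r ∧ r ≤ t + A.unit n * A.τc ∧ u r ∈ A.Out n := by
  obtain ⟨σ, hσ0, hστ, hball⟩ := A.dat (A.read n (u t)) hin.1
  have hle : t + A.unit n * σ ≤ t + A.unit n * A.τc := by linarith [A.unit_mul_le (n := n) hστ]
  have hlt : t + A.unit n * σ < S' := hle.trans_lt hT
  have hsh := A.shadow n a S' u hu t ht hin.1 hin.2 σ hσ0 hστ hlt
  have hlk := A.leak n a S' u hu t ht hin.1 hin.2 σ hσ0 hστ hlt
  have hout : A.read n (u (t + A.unit n * σ)) ∈ A.Aout := hball (Metric.mem_closedBall.2 hsh)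
  refine ⟨t + A.unit n * σ, ?_, hle, A.handoff n _ hout hlk⟩
  have : 0 ≤ A.unit n * σ := mul_nonneg (A.unit_pos n).le hσ0
  linarith

/-- **The generation-`n` pump gadget of the design**: scale `λ_n`, classes `In n` / `Out n`, floor
`E_n` (`floor_cert`), tick `unit n · τc`, realisation by `ShadowedCircuit.fires`. [cite: Tao2016AveragedNS, §1.3 pp. 10–11] -/
def gadget (n : ℕ) : PumpGadget where
  κ := S.lam n
  κ_nonneg := (S.lam_pos n).le
  In := A.In n
  Out := A.Out n
  Ein := S.Emin n
  in_floor := fun v hv => A.floor_cert n v hv.1 hv.2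
  T := A.unit n * A.τc
  T_nonneg := mul_nonneg (A.unit_pos n).le A.τc_nonneg
  fires := A.fires n

/-- The gadget's input class is the design's. [folklore] -/
@[simp] theorem gadget_In (n : ℕ) : (A.gadget n).In = A.In n := rfl
/-- The gadget's output class is the design's. [folklore] -/
@[simp] theorem gadget_Out (n : ℕ) : (A.gadget n).Out = A.Out n := rfl
/-- The gadget's tick is `unit n · τc`. [folklore] -/
@[simp] theorem gadget_T (n : ℕ) : (A.gadget n).T = A.unit n * A.τc := rfl
/-- The gadget's scale is `λ_n`. [folklore] -/
@[simp] theorem gadget_κ (n : ℕ) : (A.gadget n).κ = S.lam n := rfl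
/-- The gadget's floor is `E_n`. [folklore] -/
@[simp] theorem gadget_Ein (n : ℕ) : (A.gadget n).Ein = S.Emin n := rfl

/-- **The pump cascade of the design** (`PumpCascade S`): realisation, self-replication, floors,
clock and ignition are all theorems of the design's fields. Downstream (`PumpCascade.lifespan_le`,
`x5a`, `normBlowup`): finite lifespan `≤ T_*` of every mild trajectory from the seed when `α > 0`,
`η > 1/4`. [cite: Tao2016AveragedNS, §1.3 pp. 10–11] -/
def toPumpCascade : PumpCascade S where
  G := A.gadget
  scale := fun _ => rfl
  replicate := A.Out_subset_In
  energy := fun _ => le_rfl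
  time := A.clock
  u₀ := A.u₀
  divFree := A.divFree
  memH10df := A.memH10df
  ignite := A.seed_mem_In

/-- The cascade's gadgets are the design's. [folklore] -/
@[simp] theorem toPumpCascade_G (n : ℕ) : A.toPumpCascade.G n = A.gadget n := rfl
/-- The cascade's ignition datum is the design's seed. [folklore] -/
@[simp] theorem toPumpCascade_u₀ : A.toPumpCascade.u₀ = A.u₀ := rfl

/-! ### §4. NOISE TOLERANCE is a theorem of the design, with an explicit radius -/

/-- The design's **relative noise tolerance** `ρ = min (δ/Λ) (jin − jcore)`: an `L²`-perturbation of
relative size `< δ/Λ` cannot move a readout by `δ` (`read_lip`), and an `X^s`-perturbation of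
relative size `< jin − jcore` cannot lift core junk above the loaded threshold (`junk_perturb`). [folklore] -/
def rho : ℝ := min (A.δ / A.Λ) (A.jin - A.jcore)

/-- The tolerance is positive (`δ, Λ > 0`, `jcore < jin`). [folklore] -/
theorem rho_pos : 0 < A.rho :=
  lt_min (div_pos A.δ_pos A.Λ_pos) (sub_pos.2 A.jcore_lt)

/-- `ρ ≤ δ/Λ`. [folklore] -/
theorem rho_le_div : A.rho ≤ A.δ / A.Λ := min_le_left _ _

/-- `ρ ≤ jin − jcore`. [folklore] -/
theorem rho_le_sub : A.rho ≤ A.jin - A.jcore := min_le_right _ _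

/-- **The tolerance lemma**: for `s ≥ 0`, every state within `ρ √E_n` in `X^s_{λ_n}` of a state read
in the core at generation `n` with core junk is a generation-`n` input state (readout moved by
`< δ`, so still in `Ain` by `core_thick`; junk lifted by `< (jin − jcore) √E_n`). [folklore] -/
theorem mem_In_of_near (hs : 0 ≤ s) (n : ℕ) {v w : L2C} (hr : A.read n v ∈ A.Acore)
    (hj : A.junk n v ≤ ENNReal.ofReal (A.jcore * Real.sqrt (S.Emin n)))
    (hw : scaledSobolevNorm s (S.lam n) (w - v) < ENNReal.ofReal (A.rho * Real.sqrt (S.Emin n))) :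
    w ∈ A.In n := by
  have hE : 0 < Real.sqrt (S.Emin n) := Real.sqrt_pos.2 (S.Emin_pos n)
  refine ⟨?_, ?_⟩
  · -- readout: `dist (read w) (read v) √E ≤ Λ ‖w - v‖ < Λ ρ √E ≤ δ √E`
    have hL2 : ‖w - v‖ < A.rho * Real.sqrt (S.Emin n) := by
      have h := (enorm_le_scaledSobolevNorm hs (S.lam n) (w - v)).trans_lt hw
      rw [← ofReal_norm] at h
      exact (ENNReal.ofReal_lt_ofReal_iff_of_nonneg (norm_nonneg _)).1 h
    have hρΛ : A.Λ * A.rho ≤ A.δ := by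
      have := mul_le_mul_of_nonneg_left A.rho_le_div A.Λ_pos.le
      rwa [mul_div_cancel₀ _ A.Λ_pos.ne'] at this
    have hdist : dist (A.read n w) (A.read n v) < A.δ := by
      refine lt_of_mul_lt_mul_right ?_ hE.le
      calc dist (A.read n w) (A.read n v) * Real.sqrt (S.Emin n)
          ≤ A.Λ * ‖w - v‖ := A.read_lip n w v
        _ < A.Λ * (A.rho * Real.sqrt (S.Emin n)) := mul_lt_mul_of_pos_left hL2 A.Λ_pos
        _ = A.Λ * A.rho * Real.sqrt (S.Emin n) := by ring
        _ ≤ A.δ * Real.sqrt (S.Emin n) := mul_le_mul_of_nonneg_right hρΛ hE.le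
    exact A.core_thick _ hr (Metric.mem_ball.2 hdist)
  · -- junk: `junk w ≤ junk v + ‖w - v‖_{X^s} ≤ jcore √E + ρ √E ≤ jin √E`
    calc A.junk n w ≤ A.junk n v + scaledSobolevNorm s (S.lam n) (w - v) := A.junk_perturb n v w
      _ ≤ ENNReal.ofReal (A.jcore * Real.sqrt (S.Emin n)) +
            ENNReal.ofReal (A.rho * Real.sqrt (S.Emin n)) := add_le_add hj hw.le
      _ = ENNReal.ofReal ((A.jcore + A.rho) * Real.sqrt (S.Emin n)) := by
          rw [add_mul, ENNReal.ofReal_add (mul_nonneg A.jcore_nonneg hE.le)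
            (mul_nonneg A.rho_pos.le hE.le)]
      _ ≤ ENNReal.ofReal (A.jin * Real.sqrt (S.Emin n)) := by
          refine ENNReal.ofReal_le_ofReal (mul_le_mul_of_nonneg_right ?_ hE.le)
          linarith [A.rho_le_sub]

/-- **NOISE TOLERANCE (`RobustPumpCascade.margin`, `igniteBall`) is a theorem of the design**: for
`s ≥ 0` the design's cascade is `ρ`-robust in `X^s` with `ρ = min (δ/Λ) (jin − jcore) > 0`.
Downstream (`RobustPumpCascade.lifespan_le_of_near`, `lifespan_le_of_near_output`): STABLE clocked
blow-up — an `X^s`-ball of finite-lifespan data around the seed and around every output state. [cite: Tao2016AveragedNS, §1.3 pp. 10–11] -/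
def toRobustPumpCascade (hs : 0 ≤ s) : RobustPumpCascade S s A.rho where
  toPumpCascade := A.toPumpCascade
  margin := fun n _ hv _ _ hw => A.mem_In_of_near hs (n + 1) hv.1 hv.2 hw
  igniteBall := fun _ _ hw => A.mem_In_of_near hs 0 A.seed_read A.seed_junk hw

/-- The robust cascade's underlying cascade is the design's. [folklore] -/
@[simp] theorem toRobustPumpCascade_toPumpCascade (hs : 0 ≤ s) :
    (A.toRobustPumpCascade hs).toPumpCascade = A.toPumpCascade := rfl

/-! ### §5. LIVENESS is a theorem of the design, given `H¹⁰` control of the shadowing tube -/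

/-- **`H¹⁰` control of the shadowing tube** (static, design-level; the one extra hypothesis of
liveness): at each generation `n` there is a bound `M_n` on the `H¹⁰` norm of every `H¹⁰_df` state
whose readout is within `δsh` of the circuit tube `{Φ σ p : p ∈ Ain, 0 ≤ σ ≤ τc}` and whose
generation-`n` junk is below the running threshold. For a concrete design with `s ≥ 10` and an
`H¹⁰`-bounded design family this is a triangle inequality; for `s < 10` it is a genuine restriction
(junk small in a weak norm does not control `H¹⁰`). [folklore] -/
def H10Control : Prop :=
  ∀ n : ℕ, ∃ M : ℝ, ∀ v : L2C, MemH10df v →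
    (∃ p ∈ A.Ain, ∃ σ : ℝ, 0 ≤ σ ∧ σ ≤ A.τc ∧ dist (A.read n v) (A.Φ σ p) ≤ A.δsh) →
      A.junk n v ≤ ENNReal.ofReal (A.jrun * Real.sqrt (S.Emin n)) →
        eFourierSobolevNorm 10 v ≤ ENNReal.ofReal M

/-- **LIVENESS (`PumpCascade.Live`) is a theorem of the design** given the `H¹⁰` mild theory and
`H10Control`: every loaded `H¹⁰_df` state of every generation has a mild Navier–Stokes trajectory
outliving the tick `unit n · τc`. Proof: otherwise all its trajectories have lifespan `≤` the tick,
so (`exists_maximal_unbounded_of_lifespan_le`: local existence + continuation) a maximal one on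
`[0, S_m)`, `S_m ≤ unit n · τc`, has unbounded `H¹⁰` norm; but every instant `t' < S_m` is
`t' = unit n · σ` with `0 ≤ σ ≤ τc`, where `shadow` and `leak` (unguarded up to lifespan) place the
state in the shadowing tube with running junk, of `H¹⁰` norm `≤ M_n` — contradiction. This is the
cascade-versus-one-shot distinction of `OneShot.lean`, now DERIVED from the architecture. [cite: Tao2016AveragedNS, §6 Prop. 6.3] -/
theorem live (hth : H10MildTheory) (hctrl : A.H10Control) : A.toPumpCascade.Live := by
  intro n v hv h10
  by_contra hne
  push Not at hne
  have hle : ∀ (S' : ℝ) (u : ℝ → L2C), IsMildSolutionFor eulerForm v (Ico 0 S') u →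
      S' ≤ A.unit n * A.τc := by
    intro S' u hu
    by_contra h
    exact hne S' (lt_of_not_ge h) u hu
  obtain ⟨M, hM⟩ := hctrl n
  obtain ⟨Sm, hSm, hSmT, U, hU, -, hunb⟩ := exists_maximal_unbounded_of_lifespan_le hth h10 hle
  obtain ⟨t', ht', hlt⟩ := hunb M
  have h0 : U 0 = v := initial_eq hU ⟨le_rfl, hSm⟩ h10
  have hv' : U 0 ∈ A.In n := by rw [h0]; exact hv
  have hne0 : A.unit n ≠ 0 := (A.unit_pos n).ne'
  set σ : ℝ := t' / A.unit n with hσdef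
  have hσ0 : 0 ≤ σ := div_nonneg ht'.1 (A.unit_pos n).le
  have hσeq : A.unit n * σ = t' := by rw [mul_comm]; exact div_mul_cancel₀ t' hne0
  have hστ : σ ≤ A.τc := by
    have h1 : A.unit n * σ ≤ A.unit n * A.τc := by rw [hσeq]; exact ht'.2.le.trans hSmT
    exact le_of_mul_le_mul_left h1 (A.unit_pos n)
  have hlt' : 0 + A.unit n * σ < Sm := by rw [zero_add, hσeq]; exact ht'.2
  have hsh := A.shadow n v Sm U hU 0 le_rfl hv'.1 hv'.2 σ hσ0 hστ hlt'
  have hlk := A.leak n v Sm U hU 0 le_rfl hv'.1 hv'.2 σ hσ0 hστ hlt'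
  rw [zero_add, hσeq] at hsh hlk
  have hbd := hM (U t') (hU.1 t' ht') ⟨A.read n (U 0), hv'.1, σ, hσ0, hστ, hsh⟩ hlk
  exact absurd hlt (not_lt.2 hbd)

/-- Hence **no loaded state of the design is doomed within its tick**: the one-shot degeneracy of
`OneShot.lean` (a doomed datum as the whole generation-`0` class) is not an inhabitant of the
architecture layer (given the mild theory and `H10Control`). [folklore] -/
theorem not_doomed_of_mem_In (hth : H10MildTheory) (hctrl : A.H10Control) (n : ℕ) {v : L2C}
    (hv : v ∈ A.In n) (h10 : MemH10df v) : ¬ Doomed (A.unit n * A.τc) v :=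
  (A.live hth hctrl).not_doomed n hv h10

/-- In particular the seed is not doomed within the generation-`0` tick. [folklore] -/
theorem not_doomed_seed (hth : H10MildTheory) (hctrl : A.H10Control) :
    ¬ Doomed (A.unit 0 * A.τc) (schwartzL2 A.u₀) :=
  A.not_doomed_of_mem_In hth hctrl 0 A.seed_mem_In A.memH10df

/-- Under liveness, every generation of the design is reached from the seed by a chain of mild
segments through loaded `H¹⁰_df` states carrying the spec's high-frequency energy
(`PumpCascade.Live.exists_loaded`). [cite: Tao2016AveragedNS, §1.3 pp. 10–11] -/
theorem exists_loaded (hth : H10MildTheory) (hctrl : A.H10Control) (n : ℕ) :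
    ∃ v ∈ A.In n, MemH10df v ∧ ENNReal.ofReal (S.Emin n) ≤ highFreqEnergy (S.lam n) v :=
  (A.live hth hctrl).exists_loaded n

/-! ### §6. Self-similarity of the design (documentation predicate) -/

/-- **A self-similar design**: the generation-`n` design states are the generation-`0` ones dilated
to scale `λ_n = 2ⁿ λ₀` (Tao's `L²`-unitary `Dil`) with amplitude `√(E_n/E₀)`. This is what makes
the STATICS and CIRCUIT fields ONE finite computation rather than one per generation; it is not used
by the theorems above and is recorded for the blueprint's concrete reading. [cite: Tao2016AveragedNS, (1.11)] -/
def IsSelfSimilar : Prop :=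
  ∀ (n : ℕ) (p : O), A.recon n p =
    ((Real.sqrt (S.Emin n / S.Emin 0) : ℝ) : ℂ) • dil ((2 : ℝ) ^ n) (A.recon 0 p)

end ShadowedCircuit

end Literature.Analysis.FluidPDE.FluidComputer

end
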